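import Mathlib
import HarnessLib
import Summits.ValiantsHypothesis.ValiantsHypothesis.Theorems.LacunarySymmetroidMatrixDescartesProductPlusOneCrossingSign
import Summits.ValiantsHypothesis.ValiantsHypothesis.Theorems.LacunarySymmetroidMatrixDescartesProductPlusOneTameSector

/-!
# ValiantsHypothesis / LacunarySymmetroid — crux `MatrixDescartes` (stmt-ValiantsHypothesis-18050, V1),
# LINE (A) «product_plus_one», floor `OneChangeFloorK3`: the SEPARATING-WEIGHT LAW (every format) and the
# RATIO-ORDERED SECTOR of the pure incoherent core (K = 3, EVERY support ratio)

Setting (✓ `…ProductPlusOneCrossingSign`, ✓ `…CrossingBudget`): rows `f_j ∈ ℝ[X]`, `P = ∏ f_j`, `θ = X·d/dX`,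
`E = X·P′ − C ν·P` (the line's `eulerNumerator d a l₀` is `E` with `f_j = fewnomial d (a j)`, `ν = m·d l₀`,
✓ `eulerNumerator_eq_general`), letter log-Wronskians `W_j = f_j·θ²f_j − (θf_j)²`.  By ✓ `crossing_sign`, at a zero `z` of `E`
off the poles `z·E′(z)·P(z) = Σ_j W_j(z)·∏_{i≠j} f_i(z)²`, and by ✓ `euler_pos_roots_le_of_wronskian_neg` a NEGATIVE value of this sum
at every positive zero gives `Z₊(E) ≤ 2·Z₊(P) + 1`.

THE POINT OF THIS FILE.  The two fixed-weight window laws of record (bottom weight `x^{−p}`, ✓ `…UnswitchedWindow`; top weight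
`x^{−q}`, ✓ `…SwitchedWindow`/`…NearSwitched`; glued in ✓ `…ConflictWindow`) are the two ENDPOINTS `λ = p`, `λ = q` of a
one-parameter family, and the parameter may be chosen AFRESH AT EVERY ZERO:

* `sepWeight_identity` (every format, any rows, any level `ν`, any `λ`, any shifts `c_j` with `Σ c_j = ν`): at a zero `z` of `E`,
  `Σ_j W_j(z)·∏_{i≠j} f_i(z)² = Σ_j (W_j(z) − λ·f_j(z)·(θf_j(z) − c_j f_j(z)))·∏_{i≠j} f_i(z)²`
  (the subtracted sum is `λ·P(z)·E(z) = 0`);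
* ★ `sepWeight_wronskian_neg` — SEPARATING-WEIGHT CRITERION: if some real `λ` satisfies `W_j(z) < λ·f_j(z)·(θf_j(z) − c_j f_j(z))` for
  EVERY row, the crossing at `z` is a strict DOWN-crossing (`z E′(z) P(z) < 0`);
* ★★ `sepWeight_euler_pos_roots_le` — every format `(m, K)`, every coupling: if at every positive zero of `E` off the poles SOME weight
  `λ` (depending on the zero) separates the rows, then `Z₊(E) ≤ B + (B + 1)` for any bound `Z₊(P) ≤ B`.
  For a trinomial row `g = a + b x^p + c x^q` (`N = θg`, `M = θ²g`) the row condition reads `g·(M − λN) < N²` with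
  `M − λN = p(p−λ)·b·x^p + q(q−λ)·c·x^q`; `λ = p` is ✓ `psi_numerator_eq`'s criterion, `λ = q` is ✓ `top_numerator_eq`'s.
* `sepWeight_row_identity` / `sepWeight_row_neg` — the INTERMEDIATE weights made explicit: for `β ≥ 0` put
  `λ(β, x) = (p²β x^p + q² x^q)/(pβ x^p + q x^q) ∈ [p, q]`; then `(pβx^p + q x^q)·(W(g) − λ g N) = pq(q−p)·x^p x^q·g·(β c − b) − (pβx^p+qx^q)·N²`,
  so a row with `g(x)·(β·c − b) ≤ 0` and `θg(x) ≠ 0` is separated by `λ(β, x)` — for an incoherent no-dip row `(+,−,−)` this says: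
  UNSWITCHED (`g > 0`) with letter ratio `|b|/|c| ≤ β`, or SWITCHED (`g < 0`) with `|b|/|c| ≥ β`.
* ★★ `sepWeight_XderivP_pos_roots_le_of_ratioSeparated` (K = 3, bottom coupling, normalised chart, ANY support, ANY signs): if at every
  positive zero of `X·P′` off the poles some `β ≥ 0` has `g_j·(β c_j − b_j) ≤ 0` and `θg_j ≠ 0` for all rows, then `Z₊(X·P′) ≤ B + (B+1)`.
* ★★★ `sepWeight_ratioOrdered_incoherent` — THE RATIO-ORDERED SECTOR OF THE PURE INCOHERENT CORE: a company of `(+,−,−)` rows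
  (`a_j > 0`, `b_j, c_j < 0`) in which, at every `x > 0`, every SWITCHED row has middle/top letter ratio `b_j/c_j = |b_j|/|c_j|` at least
  that of every UNSWITCHED row (equivalently: the ratio `|b|/|c|` is non-increasing along the order of the rows' zeros; e.g. all rows
  with a COMMON tail `(b, c)`, or proportional tails) has `Z₊(X·P′) ≤ 2m + 1` — at EVERY support ratio `q/p`, with no window, balance-zone
  or near-switch hypothesis.  In the located language of the floor: «risers against pullers» cost nothing as long as every riser is at
  least as middle-heavy as every puller; the residual enemy of `OneChangeFloorK3` is a switched row that is MORE TOP-HEAVY (smaller `|b|/|c|`)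
  than some unswitched row at the same point.

HONEST FRAMING: a sector of the research floor `stub_oneChangeFloorK3` (helper, `--supports stmt-ValiantsHypothesis-18050`); NOT
`OneChangeFloorK3` / `stub_eulerBoundK3` / `stub_classRowK3` / `stub_polyLaw` / `MatrixDescartes`; `VP ≠ VNP` is NOT proved and nothing
here bears on it.  No definitions, no named facts, no sorry; Mathlib + the lane files.
-/

set_option linter.dupNamespace false

namespace Summit.ValiantsHypothesis.ValiantsHypothesis.Theorems.LacunarySymmetroidMatrixDescartes

namespace ProductPlusOne

open Polynomial Finset
open scoped BigOperators

/-! ### §1 The separating-weight identity and criterion (every format, any rows) -/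

/-- `θP = Σ_j θf_j · ∏_{i≠j} f_i` (Leibniz). [folklore] -/
theorem sepWeight_theta_prod {m : ℕ} (f : Fin m → ℝ[X]) :
    X * derivative (∏ j, f j) = ∑ j, (X * derivative (f j)) * ∏ i ∈ Finset.univ.erase j, f i := by
  classical
  rw [derivative_prod_finset, Finset.mul_sum]
  refine Finset.sum_congr rfl fun j _ => ?_
  ring

/-- `Σ_j (c_j f_j) · ∏_{i≠j} f_i = (Σ_j c_j) · P`. [folklore] -/
theorem sepWeight_sum_shift {m : ℕ} (f : Fin m → ℝ[X]) (c : Fin m → ℝ) :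
    ∑ j, (C (c j) * f j) * ∏ i ∈ Finset.univ.erase j, f i = C (∑ j, c j) * ∏ j, f j := by
  classical
  have h : ∀ j, (C (c j) * f j) * ∏ i ∈ Finset.univ.erase j, f i = C (c j) * ∏ i, f i := by
    intro j
    rw [mul_assoc, Finset.mul_prod_erase _ _ (Finset.mem_univ j)]
  simp_rw [h, ← Finset.sum_mul, map_sum]

/-- **The weighted shift is `P·E`** (polynomial identity, every format): for shifts `c_j` with `Σ c_j = ν`,
`Σ_j f_j·(θf_j − c_j f_j)·∏_{i≠j} f_i² = P·(X·P′ − C ν·P)`. [this file's lemma] -/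
theorem sepWeight_shift_poly {m : ℕ} (f : Fin m → ℝ[X]) (ν : ℝ) (c : Fin m → ℝ) (hc : ∑ j, c j = ν) :
    ∑ j, (f j * (X * derivative (f j) - C (c j) * f j)) * ∏ i ∈ Finset.univ.erase j, (f i) ^ 2
      = (∏ j, f j) * (X * derivative (∏ j, f j) - C ν * ∏ j, f j) := by
  classical
  have hmul : ∀ j, f j * ∏ i ∈ Finset.univ.erase j, f i = ∏ i, f i :=
    fun j => Finset.mul_prod_erase _ _ (Finset.mem_univ j)
  calc ∑ j, (f j * (X * derivative (f j) - C (c j) * f j)) * ∏ i ∈ Finset.univ.erase j, (f i) ^ 2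
      = ∑ j, ((X * derivative (f j) - C (c j) * f j) * ∏ i ∈ Finset.univ.erase j, f i)
          * (f j * ∏ i ∈ Finset.univ.erase j, f i) := by
        refine Finset.sum_congr rfl fun j _ => ?_
        rw [Finset.prod_pow]
        ring
    _ = (∑ j, ((X * derivative (f j)) * ∏ i ∈ Finset.univ.erase j, f i)
          - ∑ j, (C (c j) * f j) * ∏ i ∈ Finset.univ.erase j, f i) * ∏ i, f i := by
        rw [← Finset.sum_sub_distrib, Finset.sum_mul]
        refine Finset.sum_congr rfl fun j _ => ?_
        rw [hmul j]
        ring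
    _ = (∏ j, f j) * (X * derivative (∏ j, f j) - C ν * ∏ j, f j) := by
        rw [← sepWeight_theta_prod, sepWeight_sum_shift, hc]
        ring

/-- **SEPARATING-WEIGHT IDENTITY** (every format, any rows `f_j`, any level `ν`, any weight `λ`, any shifts `c_j` with `Σ c_j = ν`):
at a zero `z` of `E = X·P′ − C ν·P`,
`Σ_j W_j(z)·∏_{i≠j} f_i(z)² = Σ_j (W_j(z) − λ·f_j(z)·(θf_j(z) − c_j·f_j(z)))·∏_{i≠j} f_i(z)²`
(the subtracted sum is `λ·P(z)·E(z) = 0`, ✓ `sepWeight_shift_poly`). [this file's theorem] -/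
theorem sepWeight_identity {m : ℕ} (f : Fin m → ℝ[X]) (ν z lam : ℝ) (c : Fin m → ℝ) (hc : ∑ j, c j = ν)
    (hEz : (X * derivative (∏ j, f j) - C ν * ∏ j, f j).eval z = 0) :
    ∑ j, ((f j * (X * derivative (X * derivative (f j))) - (X * derivative (f j)) ^ 2).eval z * ∏ i ∈ Finset.univ.erase j, ((f i).eval z) ^ 2)
      = ∑ j, (((f j * (X * derivative (X * derivative (f j))) - (X * derivative (f j)) ^ 2).eval z - lam * ((f j).eval z * ((X * derivative (f j)).eval z - c j * (f j).eval z))) * ∏ i ∈ Finset.univ.erase j, ((f i).eval z) ^ 2) := by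
  classical
  rw [← sub_eq_zero, ← Finset.sum_sub_distrib]
  have hterm : ∀ j : Fin m, (f j * (X * derivative (X * derivative (f j))) - (X * derivative (f j)) ^ 2).eval z * ∏ i ∈ Finset.univ.erase j, ((f i).eval z) ^ 2 - ((f j * (X * derivative (X * derivative (f j))) - (X * derivative (f j)) ^ 2).eval z - lam * ((f j).eval z * ((X * derivative (f j)).eval z - c j * (f j).eval z))) * ∏ i ∈ Finset.univ.erase j, ((f i).eval z) ^ 2 = lam * (((f j).eval z * ((X * derivative (f j)).eval z - c j * (f j).eval z)) * ∏ i ∈ Finset.univ.erase j, ((f i).eval z) ^ 2) := fun j => by ring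
  rw [Finset.sum_congr rfl (fun j _ => hterm j), ← Finset.mul_sum]
  have hpoly := congrArg (Polynomial.eval z) (sepWeight_shift_poly f ν c hc)
  rw [eval_finsetSum] at hpoly
  simp only [eval_mul, eval_sub, eval_C, eval_prod, eval_pow] at hpoly
  have hS : ∑ j, (((f j).eval z * ((X * derivative (f j)).eval z - c j * (f j).eval z)) * ∏ i ∈ Finset.univ.erase j, ((f i).eval z) ^ 2) = (∏ j, (f j).eval z) * (X * derivative (∏ j, f j) - C ν * ∏ j, f j).eval z := by
    simp only [eval_mul, eval_X, eval_sub, eval_C, eval_prod] at hpoly ⊢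
    exact hpoly
  rw [hS, hEz, mul_zero, mul_zero]

/-- ★ **SEPARATING-WEIGHT CRITERION** (every format): at a zero `z` of `E` off the poles, if ONE real weight `λ` satisfies
`W_j(z) < λ·f_j(z)·(θf_j(z) − c_j f_j(z))` for EVERY row (`Σ c_j = ν`), then the total letter log-Wronskian is negative there — by
✓ `crossing_sign` the zero is a strict DOWN-crossing (`z·E′(z)·P(z) < 0`, `sepWeight_crossing_neg`). [this file's theorem] -/
theorem sepWeight_wronskian_neg {m : ℕ} (hm : 0 < m) (f : Fin m → ℝ[X]) (ν z lam : ℝ) (c : Fin m → ℝ)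
    (hc : ∑ j, c j = ν) (hEz : (X * derivative (∏ j, f j) - C ν * ∏ j, f j).eval z = 0)
    (hfz : ∀ i, (f i).eval z ≠ 0)
    (hsep : ∀ j, (f j * (X * derivative (X * derivative (f j))) - (X * derivative (f j)) ^ 2).eval z < lam * ((f j).eval z * ((X * derivative (f j)).eval z - c j * (f j).eval z))) :
    ∑ j, ((f j * (X * derivative (X * derivative (f j))) - (X * derivative (f j)) ^ 2).eval z * ∏ i ∈ Finset.univ.erase j, ((f i).eval z) ^ 2) < 0 := by
  rw [sepWeight_identity f ν z lam c hc hEz]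
  refine Finset.sum_neg (fun j _ => ?_) ⟨⟨0, hm⟩, Finset.mem_univ _⟩
  refine mul_neg_of_neg_of_pos (sub_neg.mpr (hsep j)) (Finset.prod_pos fun i _ => ?_)
  have := hfz i
  positivity

/-- ★ the same in crossing currency: `z·E′(z)·P(z) < 0`. [this file's theorem] -/
theorem sepWeight_crossing_neg {m : ℕ} (hm : 0 < m) (f : Fin m → ℝ[X]) (ν z lam : ℝ) (c : Fin m → ℝ)
    (hc : ∑ j, c j = ν) (hEz : (X * derivative (∏ j, f j) - C ν * ∏ j, f j).eval z = 0)
    (hfz : ∀ i, (f i).eval z ≠ 0)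
    (hsep : ∀ j, (f j * (X * derivative (X * derivative (f j))) - (X * derivative (f j)) ^ 2).eval z < lam * ((f j).eval z * ((X * derivative (f j)).eval z - c j * (f j).eval z))) :
    z * (derivative (X * derivative (∏ j, f j) - C ν * ∏ j, f j)).eval z * (∏ j, f j).eval z < 0 := by
  rw [crossing_sign f ν z hEz]
  exact sepWeight_wronskian_neg hm f ν z lam c hc hEz hfz hsep

/-- ★★ **THE SEPARATING-WEIGHT LAW** (every format `(m, K)`, every coupling/level `ν`, any rows): if at EVERY positive zero `z` of
`E = X·P′ − C ν·P` off the poles SOME weight `λ` and shifts `c_j` (`Σ c_j = ν`; both may depend on `z`) separate the rows, then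
`Z₊(E) ≤ B + (B + 1)` for any bound `Z₊(P) ≤ B` (✓ `euler_pos_roots_le_of_wronskian_neg`). [this file's theorem] -/
theorem sepWeight_euler_pos_roots_le {m : ℕ} (f : Fin m → ℝ[X]) (hP0 : (∏ j, f j) ≠ 0) (ν : ℝ) (B : ℕ)
    (hZ : ((∏ j, f j).roots.toFinset.filter (fun t => 0 < t)).card ≤ B)
    (hsep : ∀ z : ℝ, 0 < z → (∀ i, (f i).eval z ≠ 0) → (X * derivative (∏ j, f j) - C ν * ∏ j, f j).eval z = 0 →
      ∃ lam : ℝ, ∃ c : Fin m → ℝ, (∑ j, c j = ν) ∧ ∀ j, (f j * (X * derivative (X * derivative (f j))) - (X * derivative (f j)) ^ 2).eval z < lam * ((f j).eval z * ((X * derivative (f j)).eval z - c j * (f j).eval z))) :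
    ((X * derivative (∏ j, f j) - C ν * ∏ j, f j).roots.toFinset.filter (fun t => 0 < t)).card ≤ B + (B + 1) := by
  classical
  rcases Nat.eq_zero_or_pos m with hm | hm
  · subst hm
    have hE : ((X * derivative (∏ j, f j) - C ν * ∏ j, f j) : ℝ[X]) = C (-ν) := by
      simp [map_neg]
    rw [hE, roots_C, Multiset.toFinset_zero, Finset.filter_empty, Finset.card_empty]
    exact Nat.zero_le _
  refine euler_pos_roots_le_of_wronskian_neg f hP0 ν B hZ (fun z hz hPz hEz => ?_)
  have hfz : ∀ i, (f i).eval z ≠ 0 := by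
    intro i hi
    apply hPz
    rw [eval_prod]
    exact Finset.prod_eq_zero (Finset.mem_univ i) hi
  obtain ⟨lam, c, hc, hrow⟩ := hsep z hz hfz hEz
  exact sepWeight_wronskian_neg hm f ν z lam c hc hEz hfz hrow

/-! ### §2 The intermediate weights for a trinomial row (K = 3): explicit algebra -/

/-- evaluation of `θg` for a trinomial row `g = a + b X^{e+1} + c X^{e+k+2}`:
`(X·g′)(x) = (e+1)·b·x^{e+1} + (e+k+2)·c·x^{e+k+2}`. [folklore] -/
theorem sepWeight_eval_theta (a b c : ℝ) (e k : ℕ) (x : ℝ) :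
    (X * derivative (C a + C b * X ^ (e + 1) + C c * X ^ (e + k + 2)) : ℝ[X]).eval x
      = ((e : ℝ) + 1) * b * x ^ (e + 1) + ((e : ℝ) + k + 2) * c * x ^ (e + k + 2) := by
  simp only [derivative_mul, derivative_C, zero_mul, derivative_X_pow, zero_add, eval_mul, eval_X,
    eval_add, eval_C, eval_pow, eval_natCast, map_add, map_natCast]
  push_cast
  ring

/-- `θg` of a trinomial row as a polynomial. [folklore] -/
theorem sepWeight_theta_row (a b c : ℝ) (e k : ℕ) :
    (X * derivative (C a + C b * X ^ (e + 1) + C c * X ^ (e + k + 2)) : ℝ[X])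
      = C (((e : ℝ) + 1) * b) * X ^ (e + 1) + C (((e : ℝ) + k + 2) * c) * X ^ (e + k + 2) := by
  simp only [derivative_mul, derivative_C, zero_mul, derivative_X_pow, zero_add, map_mul, map_add,
    map_natCast, map_ofNat, map_one]
  push_cast
  ring

/-- evaluation of the letter log-Wronskian of a trinomial row: `W(g)(x) = g(x)·M(x) − N(x)²` with `N = θg`,
`M(x) = (e+1)²·b·x^{e+1} + (e+k+2)²·c·x^{e+k+2}`. [folklore] -/
theorem sepWeight_eval_wronskian (a b c : ℝ) (e k : ℕ) (x : ℝ) :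
    ((C a + C b * X ^ (e + 1) + C c * X ^ (e + k + 2)) * (X * derivative (X * derivative
        (C a + C b * X ^ (e + 1) + C c * X ^ (e + k + 2)))) - (X * derivative (C a + C b * X ^ (e + 1) + C c * X ^ (e + k + 2))) ^ 2
        : ℝ[X]).eval x
      = (a + b * x ^ (e + 1) + c * x ^ (e + k + 2))
          * (((e : ℝ) + 1) ^ 2 * b * x ^ (e + 1) + ((e : ℝ) + k + 2) ^ 2 * c * x ^ (e + k + 2))
        - (((e : ℝ) + 1) * b * x ^ (e + 1) + ((e : ℝ) + k + 2) * c * x ^ (e + k + 2)) ^ 2 := by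
  rw [sepWeight_theta_row]
  have hθθ := sepWeight_theta_row 0 (((e : ℝ) + 1) * b) (((e : ℝ) + k + 2) * c) e k
  rw [map_zero, zero_add] at hθθ
  rw [hθθ]
  simp only [eval_sub, eval_mul, eval_add, eval_pow, eval_C, eval_X]
  ring

/-- **The intermediate weight, row identity** (pure algebra; `X, Y` stand for `x^p, x^q`, `p < q` the two gaps, `β` the pivot ratio):
with `g = a + bX + cY`, `N = p b X + q c Y`, `M = p² b X + q² c Y`, `D = p β X + q Y`, `Λ = p² β X + q² Y` (so `λ = Λ/D`),
`D·(g M − N²) − Λ·g·N = p q (q − p)·X·Y·g·(β c − b) − D·N²`. [this file's lemma] -/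
theorem sepWeight_row_identity (p q β a b c X Y : ℝ) :
    (p * β * X + q * Y) * ((a + b * X + c * Y) * (p ^ 2 * b * X + q ^ 2 * c * Y) - (p * b * X + q * c * Y) ^ 2)
        - (p ^ 2 * β * X + q ^ 2 * Y) * ((a + b * X + c * Y) * (p * b * X + q * c * Y))
      = p * q * (q - p) * X * Y * ((a + b * X + c * Y) * (β * c - b))
        - (p * β * X + q * Y) * (p * b * X + q * c * Y) ^ 2 := by
  ring

/-- **The intermediate weight separates a ratio-separated row**: `0 < p < q`, `X, Y > 0`, `β ≥ 0`, `g·(β c − b) ≤ 0`, `N ≠ 0` ⟹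
`W(g) < λ·(g·N)` with `λ = (p²βX + q²Y)/(pβX + qY)` (for `λ = p`, i.e. `β → ∞`, resp. `λ = q`, i.e. `β = 0`, compare ✓ `psi_numerator_eq` /
✓ `top_numerator_eq`). [this file's lemma] -/
theorem sepWeight_row_neg {p q β a b c X Y : ℝ} (hp : 0 < p) (hpq : p < q) (hX : 0 < X) (hY : 0 < Y) (hβ : 0 ≤ β)
    (hsep : (a + b * X + c * Y) * (β * c - b) ≤ 0) (hN : p * b * X + q * c * Y ≠ 0) :
    (a + b * X + c * Y) * (p ^ 2 * b * X + q ^ 2 * c * Y) - (p * b * X + q * c * Y) ^ 2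
      < (p ^ 2 * β * X + q ^ 2 * Y) / (p * β * X + q * Y) * ((a + b * X + c * Y) * (p * b * X + q * c * Y)) := by
  have hq : 0 < q := hp.trans hpq
  have hD : 0 < p * β * X + q * Y := by
    have h1 : 0 ≤ p * β * X := by positivity
    have h2 : 0 < q * Y := mul_pos hq hY
    linarith
  have key := sepWeight_row_identity p q β a b c X Y
  have hN2 : 0 < (p * b * X + q * c * Y) ^ 2 := by positivity
  have hcoef : 0 < p * q * (q - p) * X * Y := by
    have : 0 < q - p := sub_pos.mpr hpq
    positivity
  have hneg : (p * β * X + q * Y) * ((a + b * X + c * Y) * (p ^ 2 * b * X + q ^ 2 * c * Y) - (p * b * X + q * c * Y) ^ 2)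
      - (p ^ 2 * β * X + q ^ 2 * Y) * ((a + b * X + c * Y) * (p * b * X + q * c * Y)) < 0 := by
    rw [key]
    nlinarith [mul_nonpos_of_nonneg_of_nonpos hcoef.le hsep, mul_pos hD hN2]
  rw [div_mul_eq_mul_div, lt_div_iff₀ hD]
  linarith

/-! ### §3 K = 3, bottom coupling: the ratio-separated law and the RATIO-ORDERED SECTOR of the pure incoherent core -/

/-- ★★ **RATIO-SEPARATED LAW** (K = 3, normalised chart `g_j = a_j + b_j X^{e+1} + c_j X^{e+k+2}`, bottom coupling, ANY support,
ANY signs): if at every positive zero `z` of `X·P′` off the poles some pivot `β ≥ 0` has `g_j(z)·(β c_j − b_j) ≤ 0` and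
`θg_j(z) ≠ 0` for every row, then `Z₊(X·P′) ≤ B + (B + 1)` for any bound `Z₊(P) ≤ B`. [this file's theorem] -/
theorem sepWeight_XderivP_pos_roots_le_of_ratioSeparated {m : ℕ} (a b c : Fin m → ℝ) (e k : ℕ)
    (hP0 : (∏ j, (C (a j) + C (b j) * X ^ (e + 1) + C (c j) * X ^ (e + k + 2)) : ℝ[X]) ≠ 0) (B : ℕ)
    (hZ : ((∏ j, (C (a j) + C (b j) * X ^ (e + 1) + C (c j) * X ^ (e + k + 2)) : ℝ[X]).roots.toFinset.filter
      (fun t => 0 < t)).card ≤ B)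
    (hord : ∀ z : ℝ, 0 < z → (∀ j, a j + b j * z ^ (e + 1) + c j * z ^ (e + k + 2) ≠ 0) →
      (X * derivative (∏ j, (C (a j) + C (b j) * X ^ (e + 1) + C (c j) * X ^ (e + k + 2)))
          - C (0 : ℝ) * ∏ j, (C (a j) + C (b j) * X ^ (e + 1) + C (c j) * X ^ (e + k + 2)) : ℝ[X]).eval z = 0 →
      ∃ β : ℝ, 0 ≤ β ∧ ∀ j, (a j + b j * z ^ (e + 1) + c j * z ^ (e + k + 2)) * (β * c j - b j) ≤ 0 ∧
        ((e : ℝ) + 1) * b j * z ^ (e + 1) + ((e : ℝ) + k + 2) * c j * z ^ (e + k + 2) ≠ 0) :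
    ((X * derivative (∏ j, (C (a j) + C (b j) * X ^ (e + 1) + C (c j) * X ^ (e + k + 2)))
        - C (0 : ℝ) * ∏ j, (C (a j) + C (b j) * X ^ (e + 1) + C (c j) * X ^ (e + k + 2)) : ℝ[X]).roots.toFinset.filter
      (fun t => 0 < t)).card ≤ B + (B + 1) := by
  classical
  refine sepWeight_euler_pos_roots_le (fun j => C (a j) + C (b j) * X ^ (e + 1) + C (c j) * X ^ (e + k + 2)) hP0 0 B hZ ?_
  intro z hz hfz hEz
  have hg : ∀ j, a j + b j * z ^ (e + 1) + c j * z ^ (e + k + 2) ≠ 0 := by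
    intro j
    have h := hfz j
    simpa only [eval_add, eval_mul, eval_C, eval_pow, eval_X] using h
  obtain ⟨β, hβ, hrow⟩ := hord z hz hg hEz
  set Xv : ℝ := z ^ (e + 1) with hXv
  set Yv : ℝ := z ^ (e + k + 2) with hYv
  set p : ℝ := (e : ℝ) + 1 with hpdef
  set q : ℝ := (e : ℝ) + k + 2 with hqdef
  refine ⟨(p ^ 2 * β * Xv + q ^ 2 * Yv) / (p * β * Xv + q * Yv), fun _ => 0, by simp, fun j => ?_⟩
  rw [sepWeight_eval_wronskian, sepWeight_eval_theta]
  simp only [eval_add, eval_mul, eval_C, eval_pow, eval_X, zero_mul, sub_zero]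
  have hp : 0 < p := by rw [hpdef]; positivity
  have hpq : p < q := by rw [hpdef, hqdef]; have : (0:ℝ) ≤ k := Nat.cast_nonneg k; linarith
  have hX : 0 < Xv := by rw [hXv]; positivity
  have hY : 0 < Yv := by rw [hYv]; positivity
  exact sepWeight_row_neg hp hpq hX hY hβ (hrow j).1 (hrow j).2

/-- ★★★ **THE RATIO-ORDERED SECTOR OF THE PURE INCOHERENT CORE** (K = 3, bottom coupling, EVERY support ratio): a company of
incoherent no-dip rows `g_j = a_j + b_j X^{e+1} + c_j X^{e+k+2}`, `a_j > 0`, `b_j, c_j < 0` (the floor's `(+,−,−)` rows), such that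
at every `x > 0` every SWITCHED row (`g_j(x) < 0`) has middle/top ratio `b_j/c_j = |b_j|/|c_j|` at least that of every UNSWITCHED row
(`g_i(x) > 0`): `b_i·c_j ≤ b_j·c_i`.  Then `Z₊(X·P′) ≤ m + (m + 1)`: the c-free Euler count is LINEAR, with no ratio window.
(Examples: all rows with proportional tails `(b_j, c_j) ∈ ℝ₊·(b, c)`; more generally `|b|/|c|` non-increasing along the order of
the rows' positive zeros.) [this file's theorem] -/
theorem sepWeight_ratioOrdered_incoherent {m : ℕ} (a b c : Fin m → ℝ) (e k : ℕ)
    (hinc : ∀ j, 0 < a j ∧ b j < 0 ∧ c j < 0)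
    (hord : ∀ x : ℝ, 0 < x → ∀ j i, a j + b j * x ^ (e + 1) + c j * x ^ (e + k + 2) < 0 →
      0 < a i + b i * x ^ (e + 1) + c i * x ^ (e + k + 2) → b i * c j ≤ b j * c i) :
    ((X * derivative (∏ j, (C (a j) + C (b j) * X ^ (e + 1) + C (c j) * X ^ (e + k + 2)))
        - C (0 : ℝ) * ∏ j, (C (a j) + C (b j) * X ^ (e + 1) + C (c j) * X ^ (e + k + 2)) : ℝ[X]).roots.toFinset.filter
      (fun t => 0 < t)).card ≤ m + (m + 1) := by
  classical
  rcases Nat.eq_zero_or_pos m with hm | hm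
  · subst hm
    simp
  have hP0 : (∏ j, (C (a j) + C (b j) * X ^ (e + 1) + C (c j) * X ^ (e + k + 2)) : ℝ[X]) ≠ 0 := by
    rw [Finset.prod_ne_zero_iff]
    intro j _ h0
    have h := congrArg (Polynomial.eval 0) h0
    simp only [eval_add, eval_mul, eval_C, eval_pow, eval_X, zero_pow (Nat.succ_ne_zero _), mul_zero, add_zero,
      eval_zero] at h
    exact (hinc j).1.ne' h
  have hZ := prod_trinomial_pos_roots_le a b c e k (fun j => mul_neg_of_pos_of_neg (hinc j).1 (hinc j).2.2)
  refine sepWeight_XderivP_pos_roots_le_of_ratioSeparated a b c e k hP0 m hZ ?_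
  intro z hz hg _hEz
  -- the non-vanishing of `θg_j` for incoherent no-dip rows
  have hN : ∀ j, ((e : ℝ) + 1) * b j * z ^ (e + 1) + ((e : ℝ) + k + 2) * c j * z ^ (e + k + 2) ≠ 0 := by
    intro j
    have h1 : ((e : ℝ) + 1) * b j * z ^ (e + 1) < 0 :=
      mul_neg_of_neg_of_pos (mul_neg_of_pos_of_neg (by positivity) (hinc j).2.1) (by positivity)
    have h2 : ((e : ℝ) + k + 2) * c j * z ^ (e + k + 2) < 0 :=
      mul_neg_of_neg_of_pos (mul_neg_of_pos_of_neg (by positivity) (hinc j).2.2) (by positivity)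
    linarith
  -- the switched rows at `z`
  set S : Finset (Fin m) := Finset.univ.filter (fun j => a j + b j * z ^ (e + 1) + c j * z ^ (e + k + 2) < 0) with hS
  by_cases hSne : S.Nonempty
  · obtain ⟨j₀, hj₀, hmin⟩ := S.exists_min_image (fun j => b j / c j) hSne
    have hj₀' : a j₀ + b j₀ * z ^ (e + 1) + c j₀ * z ^ (e + k + 2) < 0 := (Finset.mem_filter.mp hj₀).2
    refine ⟨b j₀ / c j₀, le_of_lt (div_pos_of_neg_of_neg (hinc j₀).2.1 (hinc j₀).2.2), fun j => ⟨?_, hN j⟩⟩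
    rcases lt_or_gt_of_ne (hg j) with hlt | hgt
    · -- switched row: `β ≤ b_j/c_j`, so `β c_j ≥ b_j`
      have hle : b j₀ / c j₀ ≤ b j / c j := hmin j (Finset.mem_filter.mpr ⟨Finset.mem_univ _, hlt⟩)
      have h1 : b j ≤ b j₀ / c j₀ * c j := (le_div_iff_of_neg (hinc j).2.2).mp hle
      nlinarith
    · -- unswitched row: the order hypothesis against the switched row `j₀`
      have hle : b j * c j₀ ≤ b j₀ * c j := hord z hz j₀ j hj₀' hgt
      have h1 : b j₀ / c j₀ * c j ≤ b j := by
        rw [div_mul_eq_mul_div, div_le_iff_of_neg (hinc j₀).2.2]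
        exact hle
      nlinarith
  · -- no switched row: take the largest ratio as pivot
    obtain ⟨j₁, -, hmax⟩ := Finset.univ.exists_max_image (fun j => b j / c j) ⟨⟨0, hm⟩, Finset.mem_univ _⟩
    refine ⟨b j₁ / c j₁, le_of_lt (div_pos_of_neg_of_neg (hinc j₁).2.1 (hinc j₁).2.2), fun j => ⟨?_, hN j⟩⟩
    have hgt : 0 < a j + b j * z ^ (e + 1) + c j * z ^ (e + k + 2) := by
      rcases lt_or_gt_of_ne (hg j) with hlt | hgt
      · exact absurd ⟨j, Finset.mem_filter.mpr ⟨Finset.mem_univ _, hlt⟩⟩ hSne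
      · exact hgt
    have hle : b j / c j ≤ b j₁ / c j₁ := hmax j (Finset.mem_univ _)
    have h1 : b j₁ / c j₁ * c j ≤ b j := (div_le_iff_of_neg (hinc j).2.2).mp hle
    nlinarith

end ProductPlusOne

end Summit.ValiantsHypothesis.ValiantsHypothesis.Theorems.LacunarySymmetroidMatrixDescartes
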